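import Summits.BirchSwinnertonDyer.Rank1Residual.X1.RankOneRegulatorSqueeze
import HarnessLib

/-!
# Route R on X1 ∩ {r = 1}, sequel — the UNCONDITIONAL half of the regulator squeeze:
# `ord_p #Ш(E/ℚ)[p^∞] ≤ ord_p c₁ + 1 + 2·ord_p #E(ℚ)_tors − 2·ord_p #Ẽ(𝔽_p) − ord_p ∏c_ℓ − ord_p Reg_p`

HONEST FRAMING (cell `b2b-bsdres`, run/shared/lean/b2b/bsd-rank1-residual/, verbatim in every
file): the goal of the cell is to DELETE the COMBINATION-SHAPED residual classes of the
Birch–Swinnerton-Dyer formula for ALL analytic-rank `≤ 1` elliptic curves over `ℚ` — "full BSD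
formula for every rank `≤ 1` curve in class `C`" assembled STRICTLY from published theorems — so
that the rank-`≤ 1` remainder becomes exactly the CONSTRUCTION-SHAPED classes, which are TYPED
(missing-input `Prop`s), NOT attempted. This is not "finishing BSD". CLASS-OWNERS.md: row
"X1 (r = 1)" — research route; NO CLAIM BEYOND STATED CLASSES; no label change. PER-PAIR shape;
nothing is booked by this file; no preprint enters.

Unit `b2b-bsdres-x1a` (X1 prover A, gen 16). Sequel of `X1/RankOneRegulatorSqueeze.lean` (p263077), whose
`identity` gives, at a rank-one good ordinary Eisenstein pair with `ord_p [T¹](ϖ·L_p) = vc ≠ 0`,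
`ord_p #Ш(E/ℚ)[p^∞] + ord_p h(0) + ord_p Reg_p + ord_p ∏c_ℓ + 2·ord_p #Ẽ(𝔽_p) = vc + 1 + 2·ord_p #E(ℚ)_tors`
with `h ∈ Λ` the Kato–Wuthrich cofactor (`ord_p h(0) ≥ 0`). Dropping `ord_p h(0)` is Kato's direction:
an UPPER BOUND on `#Ш(E/ℚ)[p^∞]` from the two finite certificates (one modular-symbol coefficient, one
canonical `p`-adic regulator valuation — or any lower bound `v` for it), at a prime where `ρ̄_{E,p}` is
REDUCIBLE, with no Kolyvagin argument at `p`, no Heegner index and no `#Ш(E/ℚ)_an` — the Stein–Wuthrich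
`p`-adic bound (Math. Comp. 82 (2013) Thm. 6.1 / §9, `shark`) in the cell's kernel vocabulary on the
anomalous Eisenstein leaf. Theorems only; PUBLISHED facts Wuthrich 2014 Thm. 16, BMS Thm. 1.7 (odd `p`),
Mazur–Tate `σ`, modularity, GZK.

References: [Wuthrich2014] Thm. 16 (p. 397); [BalakrishnanMullerStein2015] Thm. 1.7;
[SteinWuthrich2013] Thm. 6.1, §9; [MazurSteinTate2006] Thm. 1.3; HOME/b2b-bsdres-x1a/X1-CHAIN.md §25.
-/

noncomputable section

open scoped Classical MatrixGroups ModularForm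

open PowerSeries CongruenceSubgroup WeierstrassCurve Literature.NumberTheory.EllipticCurves
  Literature.NumberTheory.EllipticCurves.ModularForms
  Literature.NumberTheory.EllipticCurves.Wuthrich2014
  Literature.NumberTheory.EllipticCurves.Rank1Residual
  Summit.BirchSwinnertonDyer.BirchSwinnertonDyer.Theorems
  Summit.BirchSwinnertonDyer.BirchSwinnertonDyer.Theorems.Rank1ResidualX1Defs
  Summit.BirchSwinnertonDyer.Rank1Residual.X1.RankOneLeadingTermSqueeze
  Summit.BirchSwinnertonDyer.Rank1Residual.X1.RankOneRegulatorSqueeze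

set_option autoImplicit false

namespace Summit.BirchSwinnertonDyer.Rank1Residual.X1.RankOneRegulatorSqueeze

/-! ## The unconditional half: `ord_p #Ш(E/ℚ)[p^∞] ≤ s` (Kato's direction, reducible `p`) -/

section UpperBound

variable {W : WeierstrassCurve ℚ} [W.IsElliptic] [W.IsGloballyMinimal] {p : ℕ} [Fact p.Prime]

/-- **Upper bound on `Ш(E/ℚ)[p^∞]` at an anomalous Eisenstein rank-one pair from the two certificates,
with NO hypothesis on their size:** on the rank-one leaf, `ord_p [T¹](ϖ·L_p) = vc ≠ 0` and
`v ≤ ord_p Reg_p` give `Ш(E/ℚ)[p^∞]` finite and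
`ord_p #Ш(E/ℚ)[p^∞] + v + ord_p ∏c_ℓ + 2·ord_p #Ẽ(𝔽_p) ≤ vc + 1 + 2·ord_p #E(ℚ)_tors` — Kato's
divisibility (Wuthrich Thm. 16, PRINTED for reducible `E[p]`) through BMS 1.7: the Stein–Wuthrich
`p`-adic bound on `#Ш` at a prime where `ρ̄_{E,p}` is REDUCIBLE, no Kolyvagin argument, no Heegner index.
[cite: Wuthrich2014, Thm. 16 (p. 397)] [cite: BalakrishnanMullerStein2015, Thm. 1.7]
[cite: SteinWuthrich2013, Thm. 6.1 and §9] [cite: MazurSteinTate2006, Thm. 1.3] -/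
theorem _root_.Summit.BirchSwinnertonDyer.Rank1Residual.X1.RankOne.Leaf.padicValNat_card_shaPrimary_le_of_coeffOneVal_of_regulatorGE
    (hW16 : Wuthrich2014.charIdeal_dvd_padicLFunction) (hS : Schneider1985_order_charGenerator_odd)
    (hMT : mazur_tate_sigma_exists_odd) (hmod : nonempty_modularParametrizationData)
    (hGZK : rank_eq_analyticRank_of_analyticRank_le_one)
    (hL : RankOne.Leaf W p) {vc : ℤ} (hvc : vc ≠ 0) (hc : AnalyticCoeffOneVal W p vc)
    {v : ℤ} (hv : ∀ Dh : PAdicHeightData W p, Dh.IsCanonical → v ≤ (padicRegulator Dh).valuation) :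
    Finite (AddCommGroup.primaryComponent W.sha p) ∧
      (padicValNat p (Nat.card (AddCommGroup.primaryComponent W.sha p)) : ℤ) + v +
          padicValNat p W.tamagawaProduct + 2 * padicValNat p (W.reductionPointCount p) ≤
        vc + 1 + 2 * padicValNat p W.torsionOrder := by
  have hX := isClassX1_of_classX1 hL.1
  obtain ⟨κ, hκ, γ, hγ, hγ'⟩ := exists_isCyclotomic_isTopGenerator_isCyclotomicVariable_holds p
  obtain ⟨D⟩ := W.nonempty_selmerDualData_holds κ γ hγ
  haveI : NeZero (W.conductorNorm ℤ) := ⟨(W.conductorNorm_pos_holds).ne'⟩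
  obtain ⟨Dm⟩ := hmod W
  obtain ⟨ϖ, -, hϖ, -⟩ := Dm.exists_rat_mul_realPeriodRat_eq_plusPeriod
  haveI : Module.Finite (IwasawaAlgebra p) D.X := D.module_finite_holds hγ
  obtain ⟨-, hfin, fE, h, -, -, -, -, hvh, key⟩ := identity hW16 hS hMT hX.two_ne
    hX.hasGoodReductionAtPrime hX.not_dvd_frobeniusTrace hX.not_hasIrreducibleModPGaloisRep
    (hL.mordellWeilRank_eq_one hGZK) hvc hc hκ hγ hγ' Dm.isNewformOf hϖ D
  obtain ⟨Dh, hDh, -⟩ := existsUnique_isCanonical_of_odd hMT W p hX.two_ne hX.hasGoodReductionAtPrime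
    hX.not_dvd_frobeniusTrace
  obtain ⟨-, hid⟩ := key Dh hDh
  have hvR := hv Dh hDh
  exact ⟨hfin, by linarith⟩

end UpperBound


/-- **Corollary: with the EXACT regulator valuation, `ord_p #Ш(E/ℚ)[p^∞] ≤ s`** where
`s = vc + 1 + 2·ord_p #E(ℚ)_tors − 2·ord_p #Ẽ(𝔽_p) − ord_p ∏c_ℓ − ord_p Reg_p` is the certified
integer of route R (the `p`-adic-BSD-predicted exponent of `Ш`): the pair's `p`-primary `Ш` is AT MOST
what `p`-adic BSD predicts, unconditionally. [cite: Wuthrich2014, Thm. 16 (p. 397)]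
[cite: BalakrishnanMullerStein2015, Thm. 1.7] [cite: SteinWuthrich2013, Thm. 6.1 and §9] -/
theorem _root_.Summit.BirchSwinnertonDyer.Rank1Residual.X1.RankOne.Leaf.padicValNat_card_shaPrimary_le_of_coeffOneVal_of_regulatorEq
    (hW16 : Wuthrich2014.charIdeal_dvd_padicLFunction) (hS : Schneider1985_order_charGenerator_odd)
    (hMT : mazur_tate_sigma_exists_odd) (hmod : nonempty_modularParametrizationData)
    (hGZK : rank_eq_analyticRank_of_analyticRank_le_one)
    {W : WeierstrassCurve ℚ} [W.IsElliptic] [W.IsGloballyMinimal] {p : ℕ} [Fact p.Prime]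
    (hL : RankOne.Leaf W p) {vc : ℤ} (hvc : vc ≠ 0) (hc : AnalyticCoeffOneVal W p vc)
    {v : ℤ} (hv : ∀ Dh : PAdicHeightData W p, Dh.IsCanonical → (padicRegulator Dh).valuation = v) :
    Finite (AddCommGroup.primaryComponent W.sha p) ∧
      (padicValNat p (Nat.card (AddCommGroup.primaryComponent W.sha p)) : ℤ) ≤
        vc + 1 + 2 * padicValNat p W.torsionOrder - 2 * padicValNat p (W.reductionPointCount p) -
          padicValNat p W.tamagawaProduct - v := by
  obtain ⟨hfin, hle⟩ := hL.padicValNat_card_shaPrimary_le_of_coeffOneVal_of_regulatorGE hW16 hS hMT hmod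
    hGZK hvc hc (v := v) (fun Dh hDh ↦ (hv Dh hDh).ge)
  exact ⟨hfin, by linarith⟩

end Summit.BirchSwinnertonDyer.Rank1Residual.X1.RankOneRegulatorSqueeze

end
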